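import Summits.ValiantsHypothesis.ValiantsHypothesis.Theorems.LacunarySymmetroidMatrixDescartesCensusWindowNMult
import Summits.ValiantsHypothesis.ValiantsHypothesis.Theorems.LacunarySymmetroidMatrixDescartesCensusWindowSupportCard

/-!
# `MatrixDescartes` census — the window lemma in SUPPORT FORM, and the NINETEEN WINDOW THEOREM for (2,6) pencils

HONEST FRAMING.  Object-search cell `pub-symmetroid`, route crux `Theses.LacunarySymmetroid.MatrixDescartes`
(ledger item stmt-ValiantsHypothesis-18050).  The window lemma with multiplicity (THEOREM N″ and its NINETEEN FORM
`newton_window_of_le_countP`, `…CensusWindowNMult.lean`) restated for an ARBITRARY real polynomial `f` in terms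
of its own support — `#supp f ≤ #Z₊^{mult}(f) + 2` ⇒ at most one consecutive same-sign pair, and the weighted
Newton row at every alternating consecutive support triple (`newton_window_support`,
`consecutive_repetition_unique`) — and the SUPPORT-FREE corollary for the V = 19 layer of door A:

`nineteen_window_two_six`: for EVERY exponent vector `d : Fin 6 → ℕ` and EVERY six real `2 × 2` matrices `S l`
(symmetric or not), if `det (Σ_l X^{d l} S l)` has at least 19 distinct positive roots, then its support has at
most `#Z₊^{mult} + 2` elements (it lies in the 21 pair sums), so the rows above hold on its own support.

`eighteen_window_three_four`: the same for `(3,4)` pencils with at least 18 distinct positive roots (support in the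
`≤ 20` triple sums) — an INHABITED layer (`ζ_sym(3,4) ≥ 18`, kernel row `M3K4F18`), so these rows are checkable on
the census eighteens, and they bind any hypothetical `(3,4)` nineteen as well.

`twenty_window_two_six` / `nineteen_window_three_four`: the Descartes-sharp layers WITH MULTIPLICITY
(`D ≤ #Z₊^{mult}`) — exactly 21 / 20 monomials, full alternation, all rows (the with-multiplicity reading of F1 + C25
used by the BOX20/BOX24 tables, R1046's kernel footnote).

This is the kernel form of the ROW SET that engine-3 g15's door-A V = 19 kit modes (Case A: 21 non-zero coefficients,
one repetition; Case B: one vanishing coefficient) take as input (fewnomial side only; the Lorentz–Gram rows are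
the tree's `…CensusLorentzRows` / `…CensusLorentzTriangle`).  A NECESSARY-condition theorem about HYPOTHETICAL
nineteens: no bound on `ζ_sym(2,6)`, nothing on `DoorA26`/`DoorA34` (OPEN), the crux, or `VP ≠ VNP`.

Support bookkeeping (`exists_strictMono_enum_support`, `consecutive_eq_enum`, `weight_enum_eq`) and the support sizes
`card_support_det_two_six_le` / `_three_four_le` are in `…CensusWindowSupportCard.lean` (distinct-currency twin, filed first).

[folklore] Descartes with parity, the cell's window lemma; support bookkeeping by `Finset.orderEmbOfFin`.
-/

-- `Summit.ValiantsHypothesis.ValiantsHypothesis.…` repeats a component by the D-0017 layout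
-- (single-conjunct summit), which the `dupNamespace` linter flags; the name is mandated.
set_option linter.dupNamespace false

namespace Summit.ValiantsHypothesis.ValiantsHypothesis.Theorems.LacunarySymmetroidMatrixDescartes.Census

open Polynomial Finset
open scoped BigOperators Polynomial

/-! ### The window lemma in support form -/

/-- **WINDOW LEMMA, SUPPORT FORM.**  Let `f ∈ ℝ[X]` have `#supp f ≤ #Z₊^{mult}(f) + 2` (at most two fewer positive
roots, counted with multiplicity, than its number of monomials less one allows twice over — i.e. Descartes slack ≤ 1
after parity).  Then at every three CONSECUTIVE support exponents `a < b < c` whose coefficients alternate,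
`f_a f_b < 0`, `f_b f_c < 0`, the weighted Newton row holds on the support:
`(|f_a| W_a)^{c−b} · (|f_c| W_c)^{b−a} ≤ (|f_b| W_b)^{c−a}`, `W_x = ∏_{u ∈ supp f, u ≠ x} |x − u|`
(written with the `u = x` factor set to `1`). [folklore] -/
theorem newton_window_support (f : ℝ[X]) (hZ : f.support.card ≤ f.roots.countP (fun x => 0 < x) + 2)
    {a b c : ℕ} (ha : a ∈ f.support) (hb : b ∈ f.support) (hc : c ∈ f.support) (hab : a < b) (hbc : b < c)
    (hcons₁ : ∀ u ∈ f.support, ¬ (a < u ∧ u < b)) (hcons₂ : ∀ u ∈ f.support, ¬ (b < u ∧ u < c))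
    (h1 : f.coeff a * f.coeff b < 0) (h2 : f.coeff b * f.coeff c < 0) :
    (|f.coeff a| * ∏ u ∈ f.support, (if u = a then (1 : ℝ) else |(a : ℝ) - u|)) ^ (c - b) *
      (|f.coeff c| * ∏ u ∈ f.support, (if u = c then (1 : ℝ) else |(c : ℝ) - u|)) ^ (b - a)
    ≤ (|f.coeff b| * ∏ u ∈ f.support, (if u = b then (1 : ℝ) else |(b : ℝ) - u|)) ^ (c - a) := by
  have hf : f ≠ 0 := by rintro rfl; simp at ha
  obtain ⟨e, he, hmem, hsurj, hsum⟩ := exists_strictMono_enum_support f hf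
  set n := f.support.card with hn
  obtain ⟨t, ht, rfl, rfl⟩ := consecutive_eq_enum he hmem hsurj ha hb hab hcons₁
  obtain ⟨t', ht', het', rfl⟩ := consecutive_eq_enum he hmem hsurj hb hc hbc hcons₂
  obtain rfl : t' = t + 1 := he.injective het'
  have hn3 : 3 ≤ n := by omega
  have hcoef : ∀ s, s < n → f.coeff (e s) ≠ 0 := fun s hs => mem_support_iff.mp (hmem s hs)
  have hZ' : n - 2 ≤ (∑ s ∈ range n, C (f.coeff (e s)) * X ^ (e s) : ℝ[X]).roots.countP (fun x => 0 < x) := by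
    rw [← hsum]; omega
  have key := newton_window_of_le_countP hn3 e he (fun s => f.coeff (e s)) hcoef hZ' (i := t) (by omega) h1 h2
  rw [weight_enum_eq he hmem hsurj t, weight_enum_eq he hmem hsurj (t + 1),
    weight_enum_eq he hmem hsurj (t + 1 + 1)] at key
  exact key

/-- **At most one repetition, support form.**  If `#supp f ≤ #Z₊^{mult}(f) + 2` then at most ONE pair of
consecutive support exponents carries coefficients of the same sign: two such pairs `(a, b)`, `(a', b')` have
`a = a'`. [folklore] -/
theorem consecutive_repetition_unique (f : ℝ[X]) (hZ : f.support.card ≤ f.roots.countP (fun x => 0 < x) + 2)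
    {a b a' b' : ℕ} (ha : a ∈ f.support) (hb : b ∈ f.support) (hab : a < b)
    (hcons : ∀ u ∈ f.support, ¬ (a < u ∧ u < b)) (hrep : 0 < f.coeff a * f.coeff b)
    (ha' : a' ∈ f.support) (hb' : b' ∈ f.support) (hab' : a' < b')
    (hcons' : ∀ u ∈ f.support, ¬ (a' < u ∧ u < b')) (hrep' : 0 < f.coeff a' * f.coeff b') : a = a' := by
  classical
  have hf : f ≠ 0 := by rintro rfl; simp at ha
  obtain ⟨e, he, hmem, hsurj, hsum⟩ := exists_strictMono_enum_support f hf
  set n := f.support.card with hn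
  obtain ⟨t, ht, rfl, rfl⟩ := consecutive_eq_enum he hmem hsurj ha hb hab hcons
  obtain ⟨t', ht', rfl, rfl⟩ := consecutive_eq_enum he hmem hsurj ha' hb' hab' hcons'
  by_contra hne
  have htt : t ≠ t' := fun h => hne (by rw [h])
  have hn1 : 1 ≤ n := by omega
  have hcoef : ∀ s, s < n → f.coeff (e s) ≠ 0 := fun s hs => mem_support_iff.mp (hmem s hs)
  have hZ' : n - 2 ≤ (∑ s ∈ range n, C (f.coeff (e s)) * X ^ (e s) : ℝ[X]).roots.countP (fun x => 0 < x) := by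
    rw [← hsum]; omega
  have hcount := card_nonalternating_le_one_of_le hn1 e he (fun s => f.coeff (e s)) hcoef hZ'
  -- the alternation count misses the two indices `t ≠ t'`, so it is at most `n − 3`
  have hle : (∑ s ∈ range (n - 1), (if f.coeff (e s) * f.coeff (e (s + 1)) < 0 then 1 else 0)) ≤ n - 1 - 2 := by
    rw [Finset.sum_boole]
    have hsub : (range (n - 1)).filter (fun s => f.coeff (e s) * f.coeff (e (s + 1)) < 0) ⊆
        ((range (n - 1)).erase t).erase t' := by
      intro s hs
      rw [Finset.mem_filter] at hs
      refine Finset.mem_erase.mpr ⟨?_, Finset.mem_erase.mpr ⟨?_, hs.1⟩⟩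
      · rintro rfl; linarith [hs.2]
      · rintro rfl; linarith [hs.2]
    have h1 : t ∈ range (n - 1) := mem_range.mpr (by omega)
    have h2 : t' ∈ (range (n - 1)).erase t := Finset.mem_erase.mpr ⟨htt.symm, mem_range.mpr (by omega)⟩
    have := Finset.card_le_card hsub
    rw [Finset.card_erase_of_mem h2, Finset.card_erase_of_mem h1, Finset.card_range] at this
    push_cast
    exact this
  omega

/-- **FULL ALTERNATION AND ALL ROWS, support form (Descartes-sharp WITH MULTIPLICITY).**  If
`#supp f ≤ #Z₊^{mult}(f) + 1` then EVERY pair of consecutive support exponents carries coefficients of opposite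
signs (so `newton_window_support` applies at every consecutive triple).  (`Var(f) = #alternating pairs ≤ #supp − 1`
and Descartes `#Z₊^{mult} ≤ Var`.)  This is the tree's C25 / F1 (`newton_cone`, `coeff_mul_coeff_neg_of_sharp`)
with roots counted with multiplicity — the reading used by the BOX20/BOX24 tables (R1046 kernel footnote). [folklore] -/
theorem consecutive_alternate_of_card_support_le (f : ℝ[X]) (hZ : f.support.card ≤ f.roots.countP (fun x => 0 < x) + 1)
    {a b : ℕ} (ha : a ∈ f.support) (hb : b ∈ f.support) (hab : a < b)
    (hcons : ∀ u ∈ f.support, ¬ (a < u ∧ u < b)) : f.coeff a * f.coeff b < 0 := by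
  classical
  have hf : f ≠ 0 := by rintro rfl; simp at ha
  obtain ⟨e, he, hmem, hsurj, hsum⟩ := exists_strictMono_enum_support f hf
  set n := f.support.card with hn
  obtain ⟨t, ht, rfl, rfl⟩ := consecutive_eq_enum he hmem hsurj ha hb hab hcons
  have hn1 : 1 ≤ n := by omega
  have hcoef : ∀ s, s < n → f.coeff (e s) ≠ 0 := fun s hs => mem_support_iff.mp (hmem s hs)
  have hV := signVariations_rsum n hn1 e he (fun s => f.coeff (e s)) hcoef
  have hD := (∑ s ∈ range n, C (f.coeff (e s)) * X ^ (e s) : ℝ[X]).roots_countP_pos_le_signVariations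
  rw [← hsum] at hD hV
  -- all `n − 1` adjacent pairs alternate: the indicator sum is `n − 1`
  have hle : (∑ s ∈ range (n - 1), (if f.coeff (e s) * f.coeff (e (s + 1)) < 0 then 1 else 0)) ≤ n - 1 := by
    calc (∑ s ∈ range (n - 1), (if f.coeff (e s) * f.coeff (e (s + 1)) < 0 then 1 else 0))
        ≤ ∑ _s ∈ range (n - 1), 1 := Finset.sum_le_sum fun s _ => by split_ifs <;> omega
      _ = n - 1 := by rw [Finset.sum_const, Finset.card_range, smul_eq_mul, mul_one]
  by_contra hge
  have hlt : (∑ s ∈ range (n - 1), (if f.coeff (e s) * f.coeff (e (s + 1)) < 0 then 1 else 0)) ≤ n - 1 - 1 := by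
    rw [Finset.sum_boole]
    have hsub : (range (n - 1)).filter (fun s => f.coeff (e s) * f.coeff (e (s + 1)) < 0) ⊆ (range (n - 1)).erase t := by
      intro s hs
      rw [Finset.mem_filter] at hs
      refine Finset.mem_erase.mpr ⟨?_, hs.1⟩
      rintro rfl; exact hge hs.2
    have := Finset.card_le_card hsub
    rw [Finset.card_erase_of_mem (mem_range.mpr (by omega)), Finset.card_range] at this
    push_cast; exact this
  omega

/-! ### Pencil corollaries: the (2,6) nineteen / twenty and (3,4) eighteen / nineteen window theorems -/

/-- **NINETEEN WINDOW THEOREM (2,6) — support-free kernel row set of the door-A V = 19 layer (fewnomial side).**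
For EVERY `d : Fin 6 → ℕ` and EVERY six real `2 × 2` matrices `S l` (symmetric or not), if
`f = det (Σ_l X^{d l} S l)` has at least `19` distinct positive roots then `#supp f ≤ #Z₊^{mult}(f) + 2`; hence
(`newton_window_support`) the weighted Newton row `(|f_a| W_a)^{c−b} (|f_c| W_c)^{b−a} ≤ (|f_b| W_b)^{c−a}`,
`W_x = ∏_{u ∈ supp f, u ≠ x} |x − u|`, holds at every three consecutive support exponents `a < b < c` with
alternating coefficients, and (`consecutive_repetition_unique`) at most ONE consecutive pair repeats a sign —
engine-3 g15's door-A COROLLARY, cases (A) and (B) at once.  A NECESSARY condition on hypothetical nineteens; no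
bound on `ζ_sym(2,6)`, `DoorA26` OPEN. [folklore] -/
theorem nineteen_window_two_six (d : Fin 6 → ℕ) (S : Fin 6 → Matrix (Fin 2) (Fin 2) ℝ) {f : ℝ[X]}
    (hf : f = Matrix.det (∑ l, ((Polynomial.X : Polynomial ℝ) ^ d l) • (S l).map Polynomial.C))
    (hZ : 19 ≤ (f.roots.toFinset.filter (fun t => 0 < t)).card) :
    f.support.card ≤ f.roots.countP (fun t => 0 < t) + 2 ∧
    (∀ {a b c : ℕ}, a ∈ f.support → b ∈ f.support → c ∈ f.support → a < b → b < c →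
      (∀ u ∈ f.support, ¬ (a < u ∧ u < b)) → (∀ u ∈ f.support, ¬ (b < u ∧ u < c)) →
      f.coeff a * f.coeff b < 0 → f.coeff b * f.coeff c < 0 →
      (|f.coeff a| * ∏ u ∈ f.support, (if u = a then (1 : ℝ) else |(a : ℝ) - u|)) ^ (c - b) *
        (|f.coeff c| * ∏ u ∈ f.support, (if u = c then (1 : ℝ) else |(c : ℝ) - u|)) ^ (b - a)
      ≤ (|f.coeff b| * ∏ u ∈ f.support, (if u = b then (1 : ℝ) else |(b : ℝ) - u|)) ^ (c - a)) := by
  have hslack : f.support.card ≤ f.roots.countP (fun t => 0 < t) + 2 := by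
    have h1 := card_support_det_two_six_le d S
    have h2 := card_posRoots_le_countP_posRoots f
    rw [← hf] at h1
    omega
  exact ⟨hslack, fun ha hb hc hab hbc hc₁ hc₂ h1 h2 =>
    newton_window_support f hslack ha hb hc hab hbc hc₁ hc₂ h1 h2⟩

/-- **TWENTY WITH MULTIPLICITY (2,6).**  If `f = det (Σ_l X^{d l} S l)` (`d : Fin 6 → ℕ`, any real `2 × 2` letters)
has at least `20` positive roots COUNTED WITH MULTIPLICITY, then `f` has exactly 21 monomials, every consecutive
pair of them alternates in sign, and the weighted Newton row holds at every consecutive triple — the with-multiplicity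
reading of the V = 20 row set (F1 + C25) used by the BOX20/BOX24 tables. [folklore] -/
theorem twenty_window_two_six (d : Fin 6 → ℕ) (S : Fin 6 → Matrix (Fin 2) (Fin 2) ℝ) {f : ℝ[X]}
    (hf : f = Matrix.det (∑ l, ((Polynomial.X : Polynomial ℝ) ^ d l) • (S l).map Polynomial.C))
    (hZ : 20 ≤ f.roots.countP (fun t => 0 < t)) :
    f.support.card = 21 ∧
    (∀ {a b : ℕ}, a ∈ f.support → b ∈ f.support → a < b → (∀ u ∈ f.support, ¬ (a < u ∧ u < b)) →
      f.coeff a * f.coeff b < 0) ∧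
    (∀ {a b c : ℕ}, a ∈ f.support → b ∈ f.support → c ∈ f.support → a < b → b < c →
      (∀ u ∈ f.support, ¬ (a < u ∧ u < b)) → (∀ u ∈ f.support, ¬ (b < u ∧ u < c)) →
      (|f.coeff a| * ∏ u ∈ f.support, (if u = a then (1 : ℝ) else |(a : ℝ) - u|)) ^ (c - b) *
        (|f.coeff c| * ∏ u ∈ f.support, (if u = c then (1 : ℝ) else |(c : ℝ) - u|)) ^ (b - a)
      ≤ (|f.coeff b| * ∏ u ∈ f.support, (if u = b then (1 : ℝ) else |(b : ℝ) - u|)) ^ (c - a)) := by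
  have h21 := card_support_det_two_six_le d S
  rw [← hf] at h21
  have hf0 : f ≠ 0 := by
    intro h0; rw [h0, roots_zero] at hZ; simp at hZ
  have hD : f.roots.countP (fun t => 0 < t) < f.support.card :=
    lt_of_le_of_lt f.roots_countP_pos_le_signVariations
      (Literature.Computability.AlgebraicComplexity.signVariations_lt_card_support hf0)
  have hcard : f.support.card = 21 := by omega
  have hs1 : f.support.card ≤ f.roots.countP (fun t => 0 < t) + 1 := by omega
  refine ⟨hcard, fun ha hb hab hcons => consecutive_alternate_of_card_support_le f hs1 ha hb hab hcons, ?_⟩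
  intro a b c ha hb hc hab hbc hc₁ hc₂
  exact newton_window_support f (by omega) ha hb hc hab hbc hc₁ hc₂
    (consecutive_alternate_of_card_support_le f hs1 ha hb hab hc₁)
    (consecutive_alternate_of_card_support_le f hs1 hb hc hbc hc₂)

/-- **EIGHTEEN WINDOW THEOREM (3,4).**  For EVERY `d : Fin 4 → ℕ` and EVERY four real `3 × 3` matrices `S l`, if
`f = det (Σ_l X^{d l} S l)` has at least `18` distinct positive roots then `#supp f ≤ #Z₊^{mult}(f) + 2` (support ⊆
the ≤ 20 triple sums), so the weighted Newton rows hold at every alternating consecutive support triple and at most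
one consecutive pair repeats a sign.  An INHABITED layer (`ζ_sym(3,4) ≥ 18`, kernel row `M3K4F18`): located exact
check on the 12 census `(3,4)` eighteens — 20 monomials each, exactly one repetition, 192/192 rows hold
(engine-6 g17 `window_check.py`).  It binds any hypothetical `(3,4)` nineteen as well; no bound on `ζ_sym(3,4)`,
`DoorA34` OPEN. [folklore] -/
theorem eighteen_window_three_four (d : Fin 4 → ℕ) (S : Fin 4 → Matrix (Fin 3) (Fin 3) ℝ) {f : ℝ[X]}
    (hf : f = Matrix.det (∑ l, ((Polynomial.X : Polynomial ℝ) ^ d l) • (S l).map Polynomial.C))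
    (hZ : 18 ≤ (f.roots.toFinset.filter (fun t => 0 < t)).card) :
    f.support.card ≤ f.roots.countP (fun t => 0 < t) + 2 ∧
    (∀ {a b c : ℕ}, a ∈ f.support → b ∈ f.support → c ∈ f.support → a < b → b < c →
      (∀ u ∈ f.support, ¬ (a < u ∧ u < b)) → (∀ u ∈ f.support, ¬ (b < u ∧ u < c)) →
      f.coeff a * f.coeff b < 0 → f.coeff b * f.coeff c < 0 →
      (|f.coeff a| * ∏ u ∈ f.support, (if u = a then (1 : ℝ) else |(a : ℝ) - u|)) ^ (c - b) *
        (|f.coeff c| * ∏ u ∈ f.support, (if u = c then (1 : ℝ) else |(c : ℝ) - u|)) ^ (b - a)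
      ≤ (|f.coeff b| * ∏ u ∈ f.support, (if u = b then (1 : ℝ) else |(b : ℝ) - u|)) ^ (c - a)) := by
  have hslack : f.support.card ≤ f.roots.countP (fun t => 0 < t) + 2 := by
    have h1 := card_support_det_three_four_le d S
    have h2 := card_posRoots_le_countP_posRoots f
    rw [← hf] at h1
    omega
  exact ⟨hslack, fun ha hb hc hab hbc hc₁ hc₂ h1 h2 =>
    newton_window_support f hslack ha hb hc hab hbc hc₁ hc₂ h1 h2⟩

/-- **NINETEEN WITH MULTIPLICITY (3,4).**  If `f = det (Σ_l X^{d l} S l)` (`d : Fin 4 → ℕ`, any real `3 × 3`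
letters) has at least `19` positive roots COUNTED WITH MULTIPLICITY, then `f` has exactly 20 monomials, every
consecutive pair alternates, and every consecutive triple satisfies the weighted Newton row (the V = 19 = D(3,4)
row set with multiplicity; `DoorA34` OPEN, nothing asserted). [folklore] -/
theorem nineteen_window_three_four (d : Fin 4 → ℕ) (S : Fin 4 → Matrix (Fin 3) (Fin 3) ℝ) {f : ℝ[X]}
    (hf : f = Matrix.det (∑ l, ((Polynomial.X : Polynomial ℝ) ^ d l) • (S l).map Polynomial.C))
    (hZ : 19 ≤ f.roots.countP (fun t => 0 < t)) :
    f.support.card = 20 ∧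
    (∀ {a b : ℕ}, a ∈ f.support → b ∈ f.support → a < b → (∀ u ∈ f.support, ¬ (a < u ∧ u < b)) →
      f.coeff a * f.coeff b < 0) ∧
    (∀ {a b c : ℕ}, a ∈ f.support → b ∈ f.support → c ∈ f.support → a < b → b < c →
      (∀ u ∈ f.support, ¬ (a < u ∧ u < b)) → (∀ u ∈ f.support, ¬ (b < u ∧ u < c)) →
      (|f.coeff a| * ∏ u ∈ f.support, (if u = a then (1 : ℝ) else |(a : ℝ) - u|)) ^ (c - b) *
        (|f.coeff c| * ∏ u ∈ f.support, (if u = c then (1 : ℝ) else |(c : ℝ) - u|)) ^ (b - a)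
      ≤ (|f.coeff b| * ∏ u ∈ f.support, (if u = b then (1 : ℝ) else |(b : ℝ) - u|)) ^ (c - a)) := by
  have h20 := card_support_det_three_four_le d S
  rw [← hf] at h20
  have hf0 : f ≠ 0 := by
    intro h0; rw [h0, roots_zero] at hZ; simp at hZ
  have hD : f.roots.countP (fun t => 0 < t) < f.support.card :=
    lt_of_le_of_lt f.roots_countP_pos_le_signVariations
      (Literature.Computability.AlgebraicComplexity.signVariations_lt_card_support hf0)
  have hcard : f.support.card = 20 := by omega
  have hs1 : f.support.card ≤ f.roots.countP (fun t => 0 < t) + 1 := by omega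
  refine ⟨hcard, fun ha hb hab hcons => consecutive_alternate_of_card_support_le f hs1 ha hb hab hcons, ?_⟩
  intro a b c ha hb hc hab hbc hc₁ hc₂
  exact newton_window_support f (by omega) ha hb hc hab hbc hc₁ hc₂
    (consecutive_alternate_of_card_support_le f hs1 ha hb hab hc₁)
    (consecutive_alternate_of_card_support_le f hs1 hb hc hbc hc₂)

end Summit.ValiantsHypothesis.ValiantsHypothesis.Theorems.LacunarySymmetroidMatrixDescartes.Census
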